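import Literature.Analysis.FluidPDE.TaoH1LocalExistence
import HarnessLib

/-!
# Tao (2011/2013), Thm. 5.4 (ii) + (iv) WITH FORCING: local existence of smooth solutions with
# explicit lifespan, for `H^∞` data and a Schwartz force on the slab
# (family `ns`, topic `Literature/Analysis/FluidPDE`)

Named fact (D-0014: `def … : Prop`, no `sorry`) from

* T. Tao, *Localisation and compactness properties of the Navier–Stokes global regularity
  problem*, Anal. PDE 6 (2013), 25–107 = arXiv:1108.1165 (`Tao2011`), §5, Thm. 5.4
  (arXiv Thm. 31, p. 18), items (i), (ii), (iv) and the note closing the proof of (iv) —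
  the INHOMOGENEOUS case (force `f`).

It is the forced twin of the tree's `tao2011_smooth_local_existence` (`TaoH1LocalExistence.lean`,
DISCHARGED by `tao2011_smooth_local_existence_holds`), which vendors the same printed theorem in the
homogeneous case `f = 0` only. The cell `ns-blowup` (E–C route `PalasekTowerBreakdown`) consumes it to
cross the end of a forced era: a bounded classical finite-energy solution of the FORCED system on a
closed slab continues classically past the slab (`ForcedClassicalContinuation`, conditional on this
fact alone; the stub `LocalContinuationAt k`, `k ≤ 1`, of the child crux `HeredityAtOne`).

## The printed statement (Tao2011, Thm. 5.4 = arXiv Thm. 31, p. 18; `ν = 1`)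

"Let `(u₀, f, T)` be `H¹` data. (i) (Strong solution) If `(u, p, u₀, f, T, 1)` is an `H¹` mild
solution, then `u ∈ C⁰_t H¹_x([0, T] × ℝ³)`. (ii) (Local existence and regularity) If
`(‖u₀‖_{H¹_x(ℝ³)} + ‖f‖_{L¹_t H¹_x(ℝ³)})⁴ T ≤ c` for a sufficiently small absolute constant
`c > 0`, then there exists a `H¹` mild solution `(u, p, u₀, f, T)` with the indicated data, with
`‖u‖_{X¹([0,T] × ℝ³)} ≲ ‖u₀‖_{H¹_x} + ‖f‖_{L¹_t H¹_x}` and more generally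
`‖u‖_{X^k([0,T] × ℝ³)} ≲_{k, ‖u₀‖_{H^k_x}, ‖f‖_{L¹_t H^k_x}, 1}` for each `k ≥ 1`. […]
(iv) (Regularity) If `(u, p, u₀, f, T, 1)` is a `H¹` mild solution, and `(u₀, f, T)` is
Schwartz, then `u` and `p` are smooth; in fact, one has
`∂ₜʲ u, ∂ₜʲ p ∈ L^∞_t H^k([0, T] × ℝ³)` for all `j, k ≥ 0`." Note closing the proof of (iv):
"these arguments did not require the full power of the hypothesis that `(u₀, f, T)` was
Schwartz; it would have sufficed to have `u₀ ∈ H^k_x(ℝ³)` and `f ∈ C^j_t H^k_x(ℝ³)` for all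
`j, k ≥ 0`."

Here (Tao2011, §1, Def. 1.1 and p. 3; §2 p. 8; p. 6): *`H¹` data* `(u₀, f, T)` means
`u₀ ∈ H¹_x(ℝ³)` divergence free and `f ∈ L^∞_t H¹_x([0, T] × ℝ³)`; a set of data is *Schwartz*
when `sup_x (1 + |x|)^k |∇ₓ^α u₀(x)| < ∞` and
`sup_{(t, x) ∈ [0, T] × ℝ³} (1 + |x|)^k |∇ₓ^α ∂ₜ^m f(t, x)| < ∞` for all `α, m, k` (p. 3); an
*`H¹` mild solution* has `u ∈ L^∞_t H¹_x ∩ L²_t H²_x`, the normalised pressure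
`p = -Δ⁻¹∂ᵢ∂ⱼ(uᵢuⱼ) + Δ⁻¹∇·f` and obeys Duhamel's formula, so that when `u`, `p` are smooth on
`[0, T] × ℝ³` the quintuple is a *smooth solution* (NS (3), (4), (5) on `[0, T] × ℝ³`, p. 3).

## Rendering

* Viscosity `ν > 0` by the rescaling of Tao's footnote 3: `u(t, x) = ν v(νt, x)`,
  `p(t, x) = ν² q(νt, x)`, `f(t, x) = ν² g(νt, x)` turn the `ν = 1` system for `(v, q, g)` on
  `[0, νT]` into the `ν` system for `(u, p, f)` on `[0, T]`; `‖v(0)‖_{H¹} = ν⁻¹‖u₀‖_{H¹}` and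
  `‖g‖_{L¹_s H¹_x([0, νT])} = ν⁻¹ ‖f‖_{L¹_t H¹_x([0, T])}`, so the smallness hypothesis of (ii)
  reads `(‖u₀‖_{H¹} + ‖f‖_{L¹_t H¹_x})⁴ T ≤ c ν³`.
* Datum: `u₀` smooth, divergence free, with `∫ ‖Dⁿu₀‖² < ∞` for every `n` (the closing note;
  Schwartz data qualify, `HasRapidSpatialDecay.lintegral_enorm_iteratedFDeriv_sq_lt_top`), exactly
  as in the unforced twin; `‖u₀‖_{H¹} ≤ A` is written `∫‖u₀‖² + ∫|∇u₀|²_F ≤ A²` with the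
  Frobenius norm of `∇u₀` (`Fluid.frobeniusNormSq`, Tao's convention).
* Force: `f : ℝ → ℝ³ → ℝ³` jointly `C^∞` on the closed slab `[0, T] × ℝ³`
  (`FluidPDE.IsSmoothSpaceTimeOn (Icc 0 T) f`) with Tao's Schwartz bounds on the slab
  (`FluidPDE.HasUniformRapidDecayOn (Icc 0 T) f`: `(1 + ‖x‖)^K ‖Dⁿ f(t, x)‖ ≤ C_{n,K}` for
  `t ∈ [0, T]`, all space–time derivatives `n` and weights `K` — VERBATIM the printed Schwartz
  condition on `f`, hence `f ∈ C^j_t H^k_x` for all `j, k` as the closing note requires), and a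
  bound `sup_{t ∈ [0,T]} (∫‖f(t)‖² + ∫|∇ₓ f(t)|²_F) ≤ B²`, so that `‖f‖_{L¹_t H¹_x} ≤ B T`; the
  smallness hypothesis is stated as `(A + B T)⁴ T ≤ c ν³` (it implies the printed one). Any other
  equivalent choice of the `H¹` quantities only changes the unspecified absolute constant `c`.
* Conclusion: VERBATIM the conclusion of the unforced twin with the force in the equation — a
  classical solution `(u, p)` of the system with force `f` on the **closed** slab `[0, T] × ℝ³`
  (`Fluid.IsClassicalNSSolutionOn (Icc 0 T) ν f u p`: jointly `C^∞` up to `t = 0` and `t = T`)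
  with `u 0 = u₀`, the `L^∞_t H^k_x` bounds of (iv) for `u` (`j = 0`), for `∂ₜu` (`j = 1`, the
  one-sided `Fluid.timeDerivWithin (Icc 0 T) u`) and for `p` (`j = 0`; with forcing the normalised
  pressure carries the `L²` term `Δ⁻¹∇·f`, which is what Tao's `p ∈ L^∞_t H^k_x`, `k ≥ 0`,
  asserts), plus the strong continuity `u ∈ C([0, T]; L²)` contained in (i). The quantitative
  `X^k` bounds of (ii), uniqueness (iii) and stability (v) are not vendored here.

Sanity (proved in the companion proof file `TaoH1LocalExistenceForcedUnforced.lean`): the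
homogeneous specialisation `f = 0`, `B = 0` of this fact is exactly the tree's
`tao2011_smooth_local_existence` (`tao2011_smooth_local_existence_forced.unforced`).

Nothing is asserted; users take `(h : tao2011_smooth_local_existence_forced)`.

## Mathlib / tree search

Mathlib has no Navier–Stokes theory. Tree (`lean search`): the homogeneous twin
`tao2011_smooth_local_existence` (discharged, `TaoH1FourierLocalExistenceHolds` /
`CheskidovShvydkoyRegularProofs`: Fourier-side Picard iteration `FourierL2Picard*`, synthesis
`TaoH1FourierMild*`); forced facts of the tree are continuation / uniqueness statements that take
a solution in Tao's class as INPUT (`lemarieRieusset2016_H1_continuation_forced`,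
`lemarieRieusset2016_lerayRate_forced`, `serrinMasuda_weak_strong_uniqueness_forced` — a theorem,
`enstrophy_le_of_serrin_forced_uniform` — a theorem); forced EXISTENCE is only typed on the torus
(`Torus.exists_classicalNS_forced_zero_datum`, steady mean-zero force) and for the LINEARISED
system (`LinearisedNSFourierForced*`). Nothing gives forced smooth local existence on `ℝ³`.
Discharge route (not done here): add the source term `∫₀ᵗ e^{-c‖ξ‖²(t-s)} (P f̂(s))(ξ) ds` to the
clamped Duhamel map of `NSFourierPicard` — it does not depend on the unknown, so the contraction
estimates of `FourierL2Picard*` apply verbatim (pattern of `LinearisedNSFourierForcedDefs`) — and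
carry the force through the synthesis `TaoH1FourierMildSolution` / `…Classical`.

## References

* T. Tao, arXiv:1108.1165 = Anal. PDE 6 (2013): Def. 1.1 and (3)–(7) (pp. 2–3), Schwartz data
  (p. 3), `H¹` data and `H¹` mild solutions (p. 6), Sobolev norms (p. 8), footnote 3 (p. 4),
  Thm. 5.4 = arXiv Thm. 31 (p. 18) with the note closing its proof. Page numbers refer to the held
  arXiv text.
-/

noncomputable section

open MeasureTheory Set Function Filter Topology
open scoped ENNReal NNReal ContDiff

namespace Literature.Analysis.FluidPDE

/-- **Tao 2011, Thm. 5.4 (ii) + (iv) WITH FORCING (with (i) and the note closing the proof of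
(iv)): local existence of smooth solutions of the forced system with lifespan controlled by the
`H¹` norms of the datum and of the force.** There is an absolute constant `c > 0` such that: for
`ν > 0`, `T > 0`, a smooth divergence-free datum `u₀ : ℝ³ → ℝ³` with `∫ ‖Dⁿu₀‖² < ∞` for every
`n`, and a force `f` jointly smooth on the closed slab `[0, T] × ℝ³` with Tao's Schwartz bounds
there (`(1 + ‖x‖)^K ‖Dⁿf(t, x)‖ ≤ C_{n,K}`, all `n`, `K`), if `‖u₀‖_{H¹} ≤ A`,
`sup_{t ∈ [0,T]} ‖f(t)‖_{H¹} ≤ B` (squared `L²` norms of the field and of its gradient, Frobenius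
norm; written with `A, B ≥ 0` as `… ≤ A²`, `… ≤ B²`) and `(A + B T)⁴ T ≤ c ν³` (Tao's (ii),
`(‖u₀‖_{H¹} + ‖f‖_{L¹_t H¹_x})⁴ T ≤ c` at `ν = 1`, after the footnote-3 rescaling; note
`‖f‖_{L¹_t H¹_x} ≤ B T`), then there is a classical solution `(u, p)` of the Navier–Stokes system
WITH FORCE `f` on the closed slab `[0, T] × ℝ³` with `u(0) = u₀` (Tao's `H¹` mild solution of
(ii), smooth on `[0, T] × ℝ³` by (iv) since `u₀ ∈ H^k_x` and `f ∈ C^j_t H^k_x` for all `j, k`;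
`p` the normalised pressure `-Δ⁻¹∂ᵢ∂ⱼ(uᵢuⱼ) + Δ⁻¹∇·f`), such that
`u, ∂ₜu, p ∈ L^∞_t H^k_x([0, T] × ℝ³)` for every `k` ((iv): `j ≤ 1` for `u`, `j = 0` for `p`)
and `u ∈ C([0, T]; L²)` ((i)). Forced twin of `tao2011_smooth_local_existence`.
[cite: Tao2011, Thm. 5.4 (ii)+(iv)] -/
def tao2011_smooth_local_existence_forced : Prop :=
  ∃ c : ℝ, 0 < c ∧ ∀ ⦃ν T : ℝ⦄, 0 < ν → 0 < T →
    ∀ ⦃u₀ : EuclideanSpace ℝ (Fin 3) → EuclideanSpace ℝ (Fin 3)⦄,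
      ContDiff ℝ ∞ u₀ → VectorCalculus.IsDivFree u₀ →
      (∀ n : ℕ, ∫⁻ x, ‖iteratedFDeriv ℝ n u₀ x‖ₑ ^ 2 < ⊤) →
    ∀ ⦃f : ℝ → EuclideanSpace ℝ (Fin 3) → EuclideanSpace ℝ (Fin 3)⦄,
      FluidPDE.IsSmoothSpaceTimeOn (Icc 0 T) f → FluidPDE.HasUniformRapidDecayOn (Icc 0 T) f →
      ∀ ⦃A B : ℝ⦄, 0 ≤ A → 0 ≤ B →
        (∫⁻ x, ‖u₀ x‖ₑ ^ 2) + (∫⁻ x, ENNReal.ofReal (FluidPDE.frobeniusNormSq (fderiv ℝ u₀ x))) ≤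
            ENNReal.ofReal (A ^ 2) →
        (∀ t ∈ Icc 0 T,
          (∫⁻ x, ‖f t x‖ₑ ^ 2) + (∫⁻ x, ENNReal.ofReal (FluidPDE.frobeniusNormSq (fderiv ℝ (f t) x))) ≤
            ENNReal.ofReal (B ^ 2)) →
        (A + B * T) ^ 4 * T ≤ c * ν ^ 3 →
        ∃ (u : ℝ → EuclideanSpace ℝ (Fin 3) → EuclideanSpace ℝ (Fin 3))
          (p : ℝ → EuclideanSpace ℝ (Fin 3) → ℝ),
          FluidPDE.IsClassicalNSSolutionOn (Icc 0 T) ν f u p ∧ u 0 = u₀ ∧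
          HasBoundedSobolevNormsOn (Icc 0 T) u ∧
          HasBoundedSobolevNormsOn (Icc 0 T) (FluidPDE.timeDerivWithin (Icc 0 T) u) ∧
          (∀ n : ℕ, ∃ C : ℝ≥0, ∀ t ∈ Icc 0 T, ∫⁻ x, ‖iteratedFDeriv ℝ n (p t) x‖ₑ ^ 2 ≤ C) ∧
          FluidPDE.ContinuousInLpOn (Icc 0 T) 2 u

end Literature.Analysis.FluidPDE

end
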